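import Mathlib
import Summits.MatrixMultiplication.Statement
import Summits.MatrixMultiplication.MatrixMultiplication.Theorems.GraphEquationsServeEngine
import Summits.MatrixMultiplication.MatrixMultiplication.Theorems.GraphEquationsAffineDeflation
import Summits.MatrixMultiplication.MatrixMultiplication.Theorems.GraphEquationsRowCriterion

/-!
# Graph equations — the SHADOW FORMULA and the serve condition as a linear system (M20e, decomp-mm-lens-5 g33)

(supports `MultiplicityReduction`, stmt-MatrixMultiplication-27806; no new definition.)

NODE-g33 §3, Lemma 1, for ARBITRARY polynomials (members of `I` or not): the `a_{ij}b_{j'l}`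
coefficient of `t ∈ ℂ[a,b,c]` is the `a_{ij}b_{j'l}` coefficient of its GRAPH RESTRICTION
`res t = t(a,b,ab) ∈ ℂ[a,b]` minus `[j = j']·`(the linear `c_{il}` coefficient of `t`)
(`coeff_ab_eq_graphRestrict_sub`; for `t ∈ I`, `res t = 0` and this is `coeffIdentity`).  Hence the
serve condition of M20b — a constant combination of outputs equals `f_q` modulo an `a⊗b`-free
remainder — is EQUIVALENT to a finite linear system on the constants whose coefficients are read off
the outputs (`abServed_iff_shadow`): `Σ_o P_o·([a_{ij}b_{j'l}] res p_o − [j=j']·[c_{il}] p_o) = −[j=j'][q=(i,l)]`.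
With it the serve engine takes the checkable form `tensorRank_le_of_shadowServed`, and (M20d) a
functional on the `a⊗b` coefficients killing all output shadows refutes it.  This is the instrument for
computing the alignment defect of explicit systems (NODE-g33 §5.1).
-/

set_option linter.dupNamespace false

noncomputable section

open scoped BigOperators

namespace Summit.MatrixMultiplication.MatrixMultiplication.Theorems.GraphEquations

open MvPolynomial
open Literature.Computability.AlgebraicComplexity

variable {n : ℕ}

/-- `t − ι(res t) ∈ I`. -/
theorem sub_liftAB_graphRestrict_mem_graphIdeal (t : MvPolynomial (GraphVars n) ℂ) :
    t - liftAB n (graphRestrict n t) ∈ graphIdeal n := by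
  rw [mem_graphIdeal_iff_graphRestrict, map_sub, graphRestrict_liftAB, sub_self]

/-- **THE SHADOW FORMULA.**  For every `t ∈ ℂ[a,b,c]`:
`[a_{ij}b_{j'l}] t = [a_{ij}b_{j'l}] (res t) − [j = j']·[c_{il}] t`. -/
theorem coeff_ab_eq_graphRestrict_sub (t : MvPolynomial (GraphVars n) ℂ) (i j j' l : Fin n) :
    coeff (Finsupp.single (Sum.inl (Sum.inl (i, j)) : GraphVars n) 1 +
        Finsupp.single (Sum.inl (Sum.inr (j', l)) : GraphVars n) 1) t =
      coeff (Finsupp.single (Sum.inl (i, j) : MatMulVars n) 1 +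
          Finsupp.single (Sum.inr (j', l) : MatMulVars n) 1) (graphRestrict n t) -
        (if j = j' then coeff (Finsupp.single (Sum.inr (i, l) : GraphVars n) 1) t else 0) := by
  have hu := sub_liftAB_graphRestrict_mem_graphIdeal t
  have hid := coeffIdentity n _ (fun x hx => eval_eq_zero_of_mem_graphIdeal hu hx) i j j' l
  rw [coeff_sub, coeff_sub, coeff_ab_liftAB, coeff_single_inr_liftAB, sub_zero] at hid
  linear_combination hid

/-- **Served ⟺ the shadow system.**  For outputs `p_o` and constants `P`:
(∃ an `a⊗b`-free remainder `r` with `Σ_o P_o p_o = f_q + r`) ⟺ for all `i j j' l`,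
`Σ_o P_o·([a_{ij}b_{j'l}] res p_o − [j=j']·[c_{il}] p_o) = −[j = j']·[q = (i,l)]`. -/
theorem abServed_iff_shadow {ο : Type*} [Fintype ο] (p : ο → MvPolynomial (GraphVars n) ℂ)
    (P : ο → ℂ) (q : Fin n × Fin n) :
    (∃ r : MvPolynomial (GraphVars n) ℂ,
        (∀ i j j' l : Fin n,
          coeff (Finsupp.single (Sum.inl (Sum.inl (i, j)) : GraphVars n) 1 +
            Finsupp.single (Sum.inl (Sum.inr (j', l)) : GraphVars n) 1) r = 0) ∧
        ∑ o, C (P o) * p o = generator n q + r) ↔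
      ∀ i j j' l : Fin n,
        ∑ o, P o * (coeff (Finsupp.single (Sum.inl (i, j) : MatMulVars n) 1 +
              Finsupp.single (Sum.inr (j', l) : MatMulVars n) 1) (graphRestrict n (p o)) -
            (if j = j' then coeff (Finsupp.single (Sum.inr (i, l) : GraphVars n) 1) (p o) else 0)) =
          -(if j = j' then (if q = (i, l) then (1 : ℂ) else 0) else 0) := by
  classical
  constructor
  · rintro ⟨r, hrab, hserve⟩ i j j' l
    have := congrArg (coeff (Finsupp.single (Sum.inl (Sum.inl (i, j)) : GraphVars n) 1 +
      Finsupp.single (Sum.inl (Sum.inr (j', l)) : GraphVars n) 1)) hserve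
    rw [coeff_sum, coeff_add, hrab, add_zero, coeff_ab_generator] at this
    simpa only [coeff_C_mul, coeff_ab_eq_graphRestrict_sub] using this
  · intro h
    refine ⟨∑ o, C (P o) * p o - generator n q, fun i j j' l => ?_, by ring⟩
    rw [coeff_sub, coeff_sum, coeff_ab_generator]
    simp only [coeff_C_mul, coeff_ab_eq_graphRestrict_sub]
    rw [h i j j' l]
    ring

/-- **THE SERVE ENGINE, checkable form.**  Outputs free over a nonscalar sequence of length `≤ N`
and, for every `q`, constants solving the shadow system ⇒ `R(⟨n,n,n⟩) ≤ 2N`. -/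
theorem tensorRank_le_of_shadowServed {N : ℕ} {ο : Type*} [Fintype ο] [DecidableEq ο]
    (p : ο → MvPolynomial (GraphVars n) ℂ)
    (hspan : ∃ gs : List (MvPolynomial (GraphVars n) ℂ), IsNonscalarSeq gs ∧ gs.length ≤ N ∧
      ∀ o, p o ∈ freeSpan {q | q ∈ gs})
    (hshadow : ∀ q : Fin n × Fin n, ∃ P : ο → ℂ, ∀ i j j' l : Fin n,
      ∑ o, P o * (coeff (Finsupp.single (Sum.inl (i, j) : MatMulVars n) 1 +
            Finsupp.single (Sum.inr (j', l) : MatMulVars n) 1) (graphRestrict n (p o)) -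
          (if j = j' then coeff (Finsupp.single (Sum.inr (i, l) : GraphVars n) 1) (p o) else 0)) =
        -(if j = j' then (if q = (i, l) then (1 : ℂ) else 0) else 0)) :
    tensorRank (matMulTensor ℂ n n n) ≤ 2 * N := by
  classical
  choose P hP using hshadow
  have h := fun q => (abServed_iff_shadow p (P q) q).mpr (hP q)
  choose r hrab hserve using h
  exact tensorRank_le_of_abServed p hspan P r hrab hserve

/-- For outputs IN the graph ideal the shadow system is the ROW system
`Σ_o P_o·[c_{q'}] p_o = [q = q']` (restricted to the pattern `j = j'`): members of `I` have clean
shadows. -/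
theorem shadow_of_mem_graphIdeal {t : MvPolynomial (GraphVars n) ℂ} (ht : t ∈ graphIdeal n)
    (i j j' l : Fin n) :
    coeff (Finsupp.single (Sum.inl (i, j) : MatMulVars n) 1 +
          Finsupp.single (Sum.inr (j', l) : MatMulVars n) 1) (graphRestrict n t) -
        (if j = j' then coeff (Finsupp.single (Sum.inr (i, l) : GraphVars n) 1) t else 0) =
      -(if j = j' then coeff (Finsupp.single (Sum.inr (i, l) : GraphVars n) 1) t else 0) := by
  rw [(mem_graphIdeal_iff_graphRestrict t).mp ht, coeff_zero, zero_sub]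

end Summit.MatrixMultiplication.MatrixMultiplication.Theorems.GraphEquations

end
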